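import Summits.SmoothPoincare4.SmoothPoincare4.Theses.EntropyRung
import Summits.SmoothPoincare4.SmoothPoincare4.Theorems.EntropyRungSubcylindricalExistenceRoundClauseEuclidean
import Literature.Geometry.Riemannian.RoundSphereProofs
import Literature.Geometry.Riemannian.AubinYamabeSphereEuclidean
import Mathlib.Analysis.Calculus.Gradient.Basic
import Mathlib.MeasureTheory.Integral.DominatedConvergence
import HarnessLib

/-!
# The Euclidean `𝒲`-clause at level `log 6 − 2` on flat `ℝ⁴`, from RoundBound by blowing the sphere up
(stub `helper_euclideanClauseOfRound` of line `green-blowup-conformal-entropy`, crux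
`EntropyRung.SubcylindricalExistence`, item stmt-SmoothPoincare4-10871)

For `τ > 0` and `v ∈ C_c^∞(ℝ⁴)` with `∫ (4πτ)⁻² v² dz = 1` we prove Perelman's `𝒲`-clause of flat `ℝ⁴`
at the level `ν(S⁴) = log 6 − 2`:
`log 6 − 2 ≤ ∫ [4τ ‖∇v‖² − v² log v² − 4 v²] (4πτ)⁻² dz`.

Proof. The landed round clause `roundClauseEuclidean`
(`EntropyRungSubcylindricalExistenceRoundClauseEuclidean.lean`) is the `𝒲`-clause at level `log 6 − 2`
of the metrics `u_l² δ`, `u_l(y) = 4l/(l²‖y‖²+4)` (the round unit `S⁴` read in a dilated stereographic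
chart), for all dilations `l > 0` and all scales. Put `Ω_l := u_l / l = 4/(l²‖y‖²+4)`, so that
`l⁻² (u_l² δ) = Ω_l² δ` is the round sphere of radius `1/l`, which tends to flat `ℝ⁴` as `l → 0`
(`Ω_l → 1`). Applying the round clause at dilation `l`, scale `τ l²` and test function `N_l^{-1/2} v`,
`N_l := ∫ (4πτ)⁻² v² Ω_l⁴` (so that the normalisation holds exactly, `(4π τ l²)⁻² u_l⁴ = (4πτ)⁻² Ω_l⁴`),
and expanding, one gets for every `l > 0`
`log 6 − 2 ≤ 12 τ l² + 4τ A_l/N_l − B_l/N_l + log N_l − 4`,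
`A_l := ∫ (4πτ)⁻² ‖∇v‖² Ω_l²`, `B_l := ∫ (4πτ)⁻² v² log v² Ω_l⁴`. By dominated convergence
(`0 < Ω_l ≤ 1`, `Ω_0 = 1`) `N_l → 1`, `A_l → ∫ (4πτ)⁻² ‖∇v‖²`, `B_l → ∫ (4πτ)⁻² v² log v²` as `l → 0`,
and the right-hand side tends to `∫ [4τ ‖∇v‖² − v² log v² − 4 v²] (4πτ)⁻²`.

This is weaker than Gross's Euclidean logarithmic Sobolev inequality (level `0 > log 6 − 2`), which the
tree does not yet prove; the level `log 6 − 2` is what the line consumes.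

References: [Perelman2002Entropy] §3.1; [CaoHamiltonIlmanen2004] Thm 3.4.
-/

noncomputable section

-- the registered namespace `Summit.SmoothPoincare4.SmoothPoincare4.Theorems` repeats a component
set_option linter.dupNamespace false

open scoped Manifold ContDiff Topology ENNReal NNReal ContinuousMap RealInnerProductSpace
open Set Filter MeasureTheory
open Literature.Geometry.Lorentzian Literature.Geometry.Riemannian

namespace Summit.SmoothPoincare4.SmoothPoincare4.Theorems

namespace EuclideanClauseOfRound

/-! ## Elementary lemmas -/

/-- `x ^ (−4/2) = (x²)⁻¹` for `x ≥ 0` (the Gaussian normalising exponent in dimension `4`). [folklore] -/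
theorem rpow_neg_four_div_two {x : ℝ} (hx : 0 ≤ x) : x ^ (-(4 : ℝ) / 2) = (x ^ 2)⁻¹ := by
  rw [show (-(4 : ℝ) / 2) = -(2 : ℝ) by norm_num, Real.rpow_neg hx, Real.rpow_two]

/-- Scaling of the Gaussian normalising constant: `(4π τ l²)^{−2} = (4πτ)^{−2} l^{−4}`. [folklore] -/
theorem gaussConst_scale {τ l : ℝ} (hτ : 0 < τ) (hl : 0 < l) :
    (4 * Real.pi * (τ * l ^ 2)) ^ (-(4 : ℝ) / 2) =
      (4 * Real.pi * τ) ^ (-(4 : ℝ) / 2) * (l ^ 4)⁻¹ := by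
  rw [rpow_neg_four_div_two (by positivity), rpow_neg_four_div_two (by positivity), ← mul_inv]
  congr 1
  ring

/-- The gradient of a constant multiple: `∇(c v)(y) = c • ∇v(y)` for `v` differentiable at `y`.
[folklore] -/
theorem gradient_const_mul {E : Type*} [NormedAddCommGroup E] [InnerProductSpace ℝ E]
    [CompleteSpace E] {v : E → ℝ} {y : E} (hv : DifferentiableAt ℝ v y) (c : ℝ) :
    gradient (fun y ↦ c * v y) y = c • gradient v y := by
  rw [gradient, fderiv_const_mul hv c, gradient, map_smulₛₗ]
  simp

/-- A smooth function has a continuous gradient. [folklore] -/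
theorem continuous_gradient {E : Type*} [NormedAddCommGroup E] [InnerProductSpace ℝ E]
    [CompleteSpace E] {v : E → ℝ} (hv : ContDiff ℝ ∞ v) : Continuous (gradient v) :=
  (InnerProductSpace.toDual ℝ E).symm.continuous.comp (hv.continuous_fderiv (by simp))

/-- A compactly supported function has a compactly supported gradient. [folklore] -/
theorem hasCompactSupport_gradient {E : Type*} [NormedAddCommGroup E] [InnerProductSpace ℝ E]
    [CompleteSpace E] {v : E → ℝ} (hcs : HasCompactSupport v) : HasCompactSupport (gradient v) :=
  (hcs.fderiv (𝕜 := ℝ)).comp_left (g := (InnerProductSpace.toDual ℝ E).symm) (map_zero _)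

/-- The three fixed integrands `K v²`, `K ‖∇v‖²`, `K v² log v²` of a smooth compactly supported `v`
are integrable (continuous with compact support; `t ↦ t log t` is continuous). [folklore] -/
theorem integrable_fixed {v : EuclideanSpace ℝ (Fin 4) → ℝ} (hv : ContDiff ℝ ∞ v)
    (hcs : HasCompactSupport v) (K : ℝ) :
    Integrable (fun y ↦ K * (v y) ^ 2) ∧ Integrable (fun y ↦ K * ‖gradient v y‖ ^ 2) ∧
      Integrable (fun y ↦ K * ((v y) ^ 2 * Real.log ((v y) ^ 2))) := by
  have hvc : Continuous v := hv.continuous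
  have hgc : Continuous (gradient v) := continuous_gradient hv
  have hs1 : HasCompactSupport fun y ↦ K * (v y) ^ 2 :=
    hcs.comp_left (g := fun t : ℝ ↦ K * t ^ 2) (by simp)
  have hs2 : HasCompactSupport fun y ↦ K * ‖gradient v y‖ ^ 2 :=
    (hasCompactSupport_gradient hcs).comp_left
      (g := fun w : EuclideanSpace ℝ (Fin 4) ↦ K * ‖w‖ ^ 2) (by simp)
  have hs3 : HasCompactSupport fun y ↦ K * ((v y) ^ 2 * Real.log ((v y) ^ 2)) :=
    hcs.comp_left (g := fun t : ℝ ↦ K * (t ^ 2 * Real.log (t ^ 2))) (by simp)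
  have hc1 : Continuous fun y ↦ K * (v y) ^ 2 := continuous_const.mul (hvc.pow 2)
  have hc2 : Continuous fun y ↦ K * ‖gradient v y‖ ^ 2 := continuous_const.mul (hgc.norm.pow 2)
  have hlog : Continuous fun y ↦ (v y) ^ 2 * Real.log ((v y) ^ 2) :=
    Real.continuous_mul_log.comp (hvc.pow 2)
  have hc3 : Continuous fun y ↦ K * ((v y) ^ 2 * Real.log ((v y) ^ 2)) := continuous_const.mul hlog
  exact ⟨hc1.integrable_of_hasCompactSupport hs1, hc2.integrable_of_hasCompactSupport hs2,
    hc3.integrable_of_hasCompactSupport hs3⟩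

/-! ## The conformal factor `Ω_l(y) = 4/(l²‖y‖²+4)` of the blown-up sphere -/

/-- `0 < Ω_l(y) = 4/(l²‖y‖²+4)`. [folklore] -/
theorem conformalFactor_pos (l : ℝ) (y : EuclideanSpace ℝ (Fin 4)) :
    0 < 4 / (l ^ 2 * ‖y‖ ^ 2 + 4) := by
  positivity

/-- `Ω_l(y) = 4/(l²‖y‖²+4) ≤ 1`. [folklore] -/
theorem conformalFactor_le_one (l : ℝ) (y : EuclideanSpace ℝ (Fin 4)) :
    4 / (l ^ 2 * ‖y‖ ^ 2 + 4) ≤ 1 :=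
  div_le_one_of_le₀ (le_add_of_nonneg_left (by positivity)) (by positivity)

/-- `‖Ω_l(y)^k‖ ≤ 1`. [folklore] -/
theorem norm_conformalFactor_pow_le_one (l : ℝ) (y : EuclideanSpace ℝ (Fin 4)) (k : ℕ) :
    ‖(4 / (l ^ 2 * ‖y‖ ^ 2 + 4)) ^ k‖ ≤ 1 := by
  rw [norm_pow, Real.norm_of_nonneg (conformalFactor_pos l y).le]
  exact pow_le_one₀ (conformalFactor_pos l y).le (conformalFactor_le_one l y)

/-- `f · Ω_l^k` is integrable for integrable `f` (`Ω_l^k` is continuous and bounded by `1`).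
[folklore] -/
theorem integrable_mul_conformalFactor_pow {f : EuclideanSpace ℝ (Fin 4) → ℝ} (hf : Integrable f)
    (l : ℝ) (k : ℕ) : Integrable fun y ↦ f y * (4 / (l ^ 2 * ‖y‖ ^ 2 + 4)) ^ k :=
  hf.mul_bdd (c := 1) (Continuous.aestronglyMeasurable (by fun_prop (disch := intros; positivity)))
    (ae_of_all _ fun y ↦ norm_conformalFactor_pow_le_one l y k)

/-- **Blowing the sphere up**: for integrable `f` and `k : ℕ`, `∫ f · Ω_l^k → ∫ f` as `l → 0`
(dominated convergence with bound `|f|`: `0 < Ω_l ≤ 1` and `Ω_l(y) → Ω_0(y) = 1`). [folklore] -/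
theorem tendsto_integral_mul_conformalFactor_pow {f : EuclideanSpace ℝ (Fin 4) → ℝ}
    (hf : Integrable f) (k : ℕ) :
    Tendsto (fun l : ℝ ↦ ∫ y, f y * (4 / (l ^ 2 * ‖y‖ ^ 2 + 4)) ^ k) (𝓝 0) (𝓝 (∫ y, f y)) := by
  refine tendsto_integral_filter_of_dominated_convergence (fun y ↦ ‖f y‖) ?_ ?_ hf.norm ?_
  · exact Eventually.of_forall fun l ↦
      (integrable_mul_conformalFactor_pow hf l k).aestronglyMeasurable
  · refine Eventually.of_forall fun l ↦ Eventually.of_forall fun y ↦ ?_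
    rw [norm_mul]
    exact mul_le_of_le_one_right (norm_nonneg _) (norm_conformalFactor_pow_le_one l y k)
  · refine Eventually.of_forall fun y ↦ ?_
    have hc : Continuous fun l : ℝ ↦ f y * (4 / (l ^ 2 * ‖y‖ ^ 2 + 4)) ^ k := by
      fun_prop (disch := intros; positivity)
    convert hc.tendsto 0 using 2
    norm_num

/-! ## The round clause on the blown-up sphere -/

/-- **The round clause rescaled to the blown-up sphere `Ω_l² δ`.** For `l > 0`, `τ > 0`,
`v ∈ C_c^∞(ℝ⁴)`, `K = (4πτ)⁻²` and `N = ∫ K v² Ω_l⁴ > 0`, `A = ∫ K ‖∇v‖² Ω_l²`,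
`B = ∫ K v² log v² Ω_l⁴`: the round clause `roundClauseEuclidean` at dilation `l`, scale `τ l²` and
test function `c v`, `c² = N⁻¹` (normalised since `(4π τ l²)⁻² u_l⁴ = K Ω_l⁴`, `u_l = l Ω_l`), reads
`log 6 − 2 ≤ 12 τ l² + 4τ A/N − B/N + log N − 4`. [cite: CaoHamiltonIlmanen2004, Thm 3.4] -/
theorem clause_blowup {l τ : ℝ} (hl : 0 < l) (hτ : 0 < τ) {v : EuclideanSpace ℝ (Fin 4) → ℝ}
    (hv : ContDiff ℝ ∞ v) (hcs : HasCompactSupport v) {K N A B : ℝ}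
    (hK : K = (4 * Real.pi * τ) ^ (-(4 : ℝ) / 2))
    (hN : N = ∫ y, K * (v y) ^ 2 * (4 / (l ^ 2 * ‖y‖ ^ 2 + 4)) ^ 4)
    (hA : A = ∫ y, K * ‖gradient v y‖ ^ 2 * (4 / (l ^ 2 * ‖y‖ ^ 2 + 4)) ^ 2)
    (hB : B = ∫ y, K * ((v y) ^ 2 * Real.log ((v y) ^ 2)) * (4 / (l ^ 2 * ‖y‖ ^ 2 + 4)) ^ 4)
    (hN0 : 0 < N) :
    Real.log 6 - 2 ≤ 12 * τ * l ^ 2 + 4 * τ * (A / N) - B / N + Real.log N - 4 := by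
  have hvd : Differentiable ℝ v := hv.differentiable (by simp)
  obtain ⟨hfN, hfA, hfB⟩ := integrable_fixed hv hcs K
  -- the normalising constant `c = N^{-1/2}`
  obtain ⟨c, hc0, hc2⟩ : ∃ c : ℝ, 0 < c ∧ c ^ 2 = N⁻¹ :=
    ⟨(Real.sqrt N)⁻¹, inv_pos.2 (Real.sqrt_pos.2 hN0), by rw [inv_pow, Real.sq_sqrt hN0.le]⟩
  -- the normalisation of `c v` at dilation `l` and scale `τ l²`
  have hnorm' : ∫ y, (4 * Real.pi * (τ * l ^ 2)) ^ (-(4 : ℝ) / 2) * (c * v y) ^ 2 *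
      (l * (4 / (l ^ 2 * ‖y‖ ^ 2 + 4))) ^ 4 = 1 := by
    have e : ∀ y : EuclideanSpace ℝ (Fin 4),
        (4 * Real.pi * (τ * l ^ 2)) ^ (-(4 : ℝ) / 2) * (c * v y) ^ 2 *
          (l * (4 / (l ^ 2 * ‖y‖ ^ 2 + 4))) ^ 4 =
        c ^ 2 * (K * (v y) ^ 2 * (4 / (l ^ 2 * ‖y‖ ^ 2 + 4)) ^ 4) := by
      intro y
      have hP : l ^ 2 * ‖y‖ ^ 2 + 4 ≠ 0 := by positivity
      rw [gaussConst_scale hτ hl, ← hK]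
      field_simp
    simp_rw [e]
    rw [integral_const_mul, ← hN, hc2, inv_mul_cancel₀ hN0.ne']
  -- the round clause for `c v`
  have key := roundClauseEuclidean hl (mul_pos hτ (pow_pos hl 2)) (contDiff_const.mul hv)
    (hcs.comp_left (g := fun t : ℝ ↦ c * t) (mul_zero c)) hnorm'
  -- integrability of the three rescaled integrands and splitting of the right-hand side
  have hI1 : Integrable fun y ↦ K * (v y) ^ 2 * (4 / (l ^ 2 * ‖y‖ ^ 2 + 4)) ^ 4 :=
    integrable_mul_conformalFactor_pow hfN l 4
  have hI2 : Integrable fun y ↦ K * ‖gradient v y‖ ^ 2 * (4 / (l ^ 2 * ‖y‖ ^ 2 + 4)) ^ 2 :=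
    integrable_mul_conformalFactor_pow hfA l 2
  have hI3 : Integrable fun y ↦
      K * ((v y) ^ 2 * Real.log ((v y) ^ 2)) * (4 / (l ^ 2 * ‖y‖ ^ 2 + 4)) ^ 4 :=
    integrable_mul_conformalFactor_pow hfB l 4
  have hJ1 : Integrable fun y ↦ (12 * τ * l ^ 2 * c ^ 2 - c ^ 2 * Real.log (c ^ 2) - 4 * c ^ 2) *
      (K * (v y) ^ 2 * (4 / (l ^ 2 * ‖y‖ ^ 2 + 4)) ^ 4) := hI1.const_mul _
  have hJ2 : Integrable fun y ↦ 4 * τ * c ^ 2 *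
      (K * ‖gradient v y‖ ^ 2 * (4 / (l ^ 2 * ‖y‖ ^ 2 + 4)) ^ 2) := hI2.const_mul _
  have hJ3 : Integrable fun y ↦ c ^ 2 *
      (K * ((v y) ^ 2 * Real.log ((v y) ^ 2)) * (4 / (l ^ 2 * ‖y‖ ^ 2 + 4)) ^ 4) := hI3.const_mul _
  have hJ12 : Integrable fun y ↦ (12 * τ * l ^ 2 * c ^ 2 - c ^ 2 * Real.log (c ^ 2) - 4 * c ^ 2) *
      (K * (v y) ^ 2 * (4 / (l ^ 2 * ‖y‖ ^ 2 + 4)) ^ 4) + 4 * τ * c ^ 2 *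
      (K * ‖gradient v y‖ ^ 2 * (4 / (l ^ 2 * ‖y‖ ^ 2 + 4)) ^ 2) := hJ1.add hJ2
  have hsplit : ∫ y, ((12 * τ * l ^ 2 * c ^ 2 - c ^ 2 * Real.log (c ^ 2) - 4 * c ^ 2) *
      (K * (v y) ^ 2 * (4 / (l ^ 2 * ‖y‖ ^ 2 + 4)) ^ 4) + 4 * τ * c ^ 2 *
      (K * ‖gradient v y‖ ^ 2 * (4 / (l ^ 2 * ‖y‖ ^ 2 + 4)) ^ 2) - c ^ 2 *
      (K * ((v y) ^ 2 * Real.log ((v y) ^ 2)) * (4 / (l ^ 2 * ‖y‖ ^ 2 + 4)) ^ 4)) =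
      (12 * τ * l ^ 2 * c ^ 2 - c ^ 2 * Real.log (c ^ 2) - 4 * c ^ 2) * N + 4 * τ * c ^ 2 * A
        - c ^ 2 * B := by
    rw [integral_sub hJ12 hJ3, integral_add hJ1 hJ2, integral_const_mul, integral_const_mul,
      integral_const_mul, ← hN, ← hA, ← hB]
  have halg : (12 * τ * l ^ 2 * c ^ 2 - c ^ 2 * Real.log (c ^ 2) - 4 * c ^ 2) * N
      + 4 * τ * c ^ 2 * A - c ^ 2 * B = 12 * τ * l ^ 2 + 4 * τ * (A / N) - B / N + Real.log N - 4 := by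
    rw [hc2, Real.log_inv]
    field_simp
    ring
  refine key.trans_eq ?_
  rw [← halg, ← hsplit]
  refine integral_congr_ae ?_
  filter_upwards with y
  have hP : l ^ 2 * ‖y‖ ^ 2 + 4 ≠ 0 := by positivity
  rw [gradient_const_mul (hvd y) c, norm_smul, Real.norm_eq_abs, mul_pow |c| ‖gradient v y‖ 2,
    sq_abs, gaussConst_scale hτ hl, ← hK]
  by_cases hvy : v y = 0
  · simp only [hvy, mul_zero, ne_eq, OfNat.ofNat_ne_zero, not_false_eq_true, zero_pow,
      Real.log_zero, zero_mul, sub_zero, zero_add]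
    field_simp
  · rw [mul_pow c (v y) 2, Real.log_mul (pow_ne_zero 2 hc0.ne') (pow_ne_zero 2 hvy)]
    field_simp
    ring

end EuclideanClauseOfRound

open EuclideanClauseOfRound in
/-- **Witness helper 4 — the Euclidean `𝒲`-clause at level `log 6 − 2`**: for `τ > 0` and
`v ∈ C_c^∞(ℝ⁴)` with `∫ (4πτ)⁻² v² = 1`, `log 6 − 2 ≤ ∫ [4τ‖∇v‖² − v² log v² − 4v²](4πτ)⁻²`
(RoundBound `roundClauseEuclidean` on the blown-up spheres `Ω_l² δ`, `l → 0`, by dominated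
convergence; weaker than Gross's level `0`, enough here). [cite: CaoHamiltonIlmanen2004, Thm 3.4] -/
theorem helper_euclideanClauseOfRound :
    ∀ τ : ℝ, 0 < τ → ∀ v : EuclideanSpace ℝ (Fin 4) → ℝ, ContDiff ℝ ∞ v → HasCompactSupport v → ∫ z,
      (4 * Real.pi * τ) ^ (-(4 : ℝ) / 2) * (v z) ^ 2 = 1 → Real.log 6 - 2 ≤ ∫ z, (τ * (4 * ‖gradient
      v z‖ ^ 2) - (v z) ^ 2 * Real.log ((v z) ^ 2) - 4 * (v z) ^ 2) * (4 * Real.pi * τ) ^ (-(4 : ℝ)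
      / 2) := by
  intro τ hτ v hv hcs hnorm
  set K : ℝ := (4 * Real.pi * τ) ^ (-(4 : ℝ) / 2) with hK
  obtain ⟨hfN, hfA, hfB⟩ := integrable_fixed hv hcs K
  -- the three scale functions `N_l`, `A_l`, `B_l` and the two limits `A₀`, `B₀`
  obtain ⟨N, hNdef⟩ : ∃ N : ℝ → ℝ,
      N = fun l ↦ ∫ y, K * (v y) ^ 2 * (4 / (l ^ 2 * ‖y‖ ^ 2 + 4)) ^ 4 := ⟨_, rfl⟩
  obtain ⟨A, hAdef⟩ : ∃ A : ℝ → ℝ,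
      A = fun l ↦ ∫ y, K * ‖gradient v y‖ ^ 2 * (4 / (l ^ 2 * ‖y‖ ^ 2 + 4)) ^ 2 := ⟨_, rfl⟩
  obtain ⟨B, hBdef⟩ : ∃ B : ℝ → ℝ, B = fun l ↦
      ∫ y, K * ((v y) ^ 2 * Real.log ((v y) ^ 2)) * (4 / (l ^ 2 * ‖y‖ ^ 2 + 4)) ^ 4 := ⟨_, rfl⟩
  obtain ⟨A₀, hA₀⟩ : ∃ A₀ : ℝ, A₀ = ∫ y, K * ‖gradient v y‖ ^ 2 := ⟨_, rfl⟩
  obtain ⟨B₀, hB₀⟩ : ∃ B₀ : ℝ, B₀ = ∫ y, K * ((v y) ^ 2 * Real.log ((v y) ^ 2)) := ⟨_, rfl⟩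
  -- their limits as `l → 0` (dominated convergence)
  have hN : Tendsto N (𝓝 0) (𝓝 1) := by
    rw [hNdef, ← hnorm]
    exact tendsto_integral_mul_conformalFactor_pow hfN 4
  have hA : Tendsto A (𝓝 0) (𝓝 A₀) := by
    rw [hAdef, hA₀]
    exact tendsto_integral_mul_conformalFactor_pow hfA 2
  have hB : Tendsto B (𝓝 0) (𝓝 B₀) := by
    rw [hBdef, hB₀]
    exact tendsto_integral_mul_conformalFactor_pow hfB 4
  -- the limit of the right-hand sides of the rescaled round clauses
  have hR : Tendsto (fun l : ℝ ↦ 12 * τ * l ^ 2 + 4 * τ * (A l / N l) - B l / N l + Real.log (N l) - 4)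
      (𝓝 0) (𝓝 (4 * τ * A₀ - B₀ - 4)) := by
    have hl2 : Tendsto (fun l : ℝ ↦ l ^ 2) (𝓝 0) (𝓝 (0 ^ 2)) := (continuous_pow 2).tendsto 0
    have h := ((((tendsto_const_nhds (x := 12 * τ)).mul hl2).add
      ((tendsto_const_nhds (x := 4 * τ)).mul (hA.div hN one_ne_zero))).sub
      (hB.div hN one_ne_zero)).add (hN.log one_ne_zero) |>.sub (tendsto_const_nhds (x := (4 : ℝ)))
    have e : 12 * τ * (0 : ℝ) ^ 2 + 4 * τ * (A₀ / 1) - B₀ / 1 + Real.log 1 - 4 =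
        4 * τ * A₀ - B₀ - 4 := by
      simp
    rwa [e] at h
  -- the rescaled round clauses, for all small `l > 0`
  have hev : ∀ᶠ l in 𝓝[>] (0 : ℝ),
      Real.log 6 - 2 ≤ 12 * τ * l ^ 2 + 4 * τ * (A l / N l) - B l / N l + Real.log (N l) - 4 := by
    have hNpos : ∀ᶠ l in 𝓝 (0 : ℝ), 0 < N l := hN.eventually (eventually_gt_nhds one_pos)
    filter_upwards [self_mem_nhdsWithin, mem_nhdsWithin_of_mem_nhds hNpos] with l hl hNl
    exact clause_blowup hl hτ hv hcs hK (congrFun hNdef l) (congrFun hAdef l) (congrFun hBdef l) hNl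
  have hlim : Real.log 6 - 2 ≤ 4 * τ * A₀ - B₀ - 4 :=
    ge_of_tendsto (hR.mono_left nhdsWithin_le_nhds) hev
  -- the target functional is `4τ A₀ − B₀ − 4 ∫ K v²`
  have e : ∀ z : EuclideanSpace ℝ (Fin 4),
      (τ * (4 * ‖gradient v z‖ ^ 2) - (v z) ^ 2 * Real.log ((v z) ^ 2) - 4 * (v z) ^ 2) * K =
      4 * τ * (K * ‖gradient v z‖ ^ 2) - K * ((v z) ^ 2 * Real.log ((v z) ^ 2))
        - 4 * (K * (v z) ^ 2) := by
    intro z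
    ring
  have hI12 : Integrable fun z ↦
      4 * τ * (K * ‖gradient v z‖ ^ 2) - K * ((v z) ^ 2 * Real.log ((v z) ^ 2)) :=
    (hfA.const_mul _).sub hfB
  simp_rw [e]
  rw [integral_sub hI12 (hfN.const_mul _), integral_sub (hfA.const_mul _) hfB,
    integral_const_mul (4 * τ), integral_const_mul 4, hnorm, ← hA₀, ← hB₀]
  linarith [hlim]

end Summit.SmoothPoincare4.SmoothPoincare4.Theorems

end
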